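import Literature.Topology.FourManifolds.LefschetzBaseCover
import Literature.Topology.FourManifolds.LefschetzBaseCoverSectors
import Literature.Topology.FourManifolds.LefschetzBaseCoverOverlap
import Literature.Topology.FourManifolds.LefschetzBaseArcs
import Literature.AlgebraicTopology.SingularHomology.ClopenCountFunctional
import Literature.AlgebraicTopology.SingularHomology.MayerVietorisDeltaSplit
import Literature.AlgebraicTopology.SingularHomology.MayerVietorisExactness
import Literature.AlgebraicTopology.FundamentalGroup.PathSegment
import Mathlib.Analysis.SpecialFunctions.Trigonometric.Inverse
import HarnessLib

/-!
# The standard Lefschetz base of genus `g`, VIII: functionals on `H₁(Base g; ℤ)` dual to the chain loops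

Topic `Literature/Topology/FourManifolds`; namespace `Literature.Topology.FourManifolds.LefschetzBase`.
The hard half of Milnor 1968, Thm. 9.1 / Lemma 9.4 for the concrete base (the chain loops are part
of a basis of `H₁`): there are `ℤ`-linear functionals `Ψ : H₁(Base g; ℤ) → ℤ^{2g}` with
`Ψ (h(chainLoop g i)) = e_i` (`exists_dualFunctionals`).  With the rank count of the Milnor cover
(`LefschetzBaseShadow.lean`) this yields the homology shadow `exists_isChainShadow`.

Proof (all ingredients are tree theorems): `Ψ_j = −θ_j ∘ ∂_MV`, where `∂_MV` is the Mayer–Vietoris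
connecting map of the cover `coverU g ∪ coverV g` (`LefschetzBaseCover*.lean`) and `θ_j` the counting
functional (`ClopenCountFunctional.lean`) of the clopen set `C_j = {sheet 0, sector ≤ j}` of the
overlap (`Cset`, through the index map `idxW`).  The `i`-th chain loop has the Hurewicz class of the
ARC loop (`LefschetzBaseArcs.lean`), which is split at the parameters `sA = arccos(5/16)/2π`,
`1 − sA` of each arc (`PathSegment.lean`) into the alternating form `((Q₀·P₁)·Q₁)·((Q₂·P₂)·Q₃)`,
`Q`'s in `V`, `P`'s in `U` (`altLoop`, §A–§D: along the arcs `Re x^{2g+1} = −cos 2πs`); Hatcher's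
formula (`MayerVietorisDeltaSplit.lean`) gives `∂_MV h = [A⁺(1−sA)] − [A⁺(sA)] + [A⁻(sA)] − [A⁻(1−sA)]`,
and the indices of the four switch points are `(0, i+1)`, `(0, i)`, `(1, i)`, `(1, i+1)`
(`sheetSign_arcPath`, `sectorRoot_arcPath_*`), whence `θ_j ∂_MV h(chainLoop i) = [i+1 ≤ j] − [i ≤ j] = −δ_{ij}` (§E–§F).

## References
* J. Milnor, *Singular points of complex hypersurfaces*, Ann. of Math. Studies 61 (1968), §9, Thm. 9.1, Lemma 9.4. [Milnor1968]
* A. Hatcher, *Algebraic Topology*, CUP 2002, §2.2 p. 150 (`∂[z] = [∂ z_U]`), Thm. 2A.1. [HatcherAT2002]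
-/

noncomputable section

open scoped Manifold ContDiff Topology Real
open Set Function Metric
open Literature.AlgebraicTopology.SingularHomology Literature.Topology.FourManifolds.TorusKnotMilnor
  Literature.AlgebraicTopology.FundamentalGroup.PathSegment CategoryTheory

namespace Literature.Topology.FourManifolds

namespace LefschetzBase

variable {g : ℕ}

/-! ### A. The switch parameter `sA = arccos(5/16)/(2π)` -/

/-- **The switch parameter** `sA = arccos(5/16)/2π` (`cos 2π sA = 5/16`). [folklore] -/
def sA : ℝ := Real.arccos (5 / 16) / (2 * π)

/-- `2π · sA = arccos (5/16)`. [folklore] -/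
theorem two_pi_mul_sA : 2 * π * sA = Real.arccos (5 / 16) := by
  unfold sA; field_simp

/-- `cos (2π sA) = 5/16`. [folklore] -/
theorem cos_two_pi_sA : Real.cos (2 * π * sA) = 5 / 16 := by
  rw [two_pi_mul_sA, Real.cos_arccos (by norm_num) (by norm_num)]

/-- `sA > 0`. [folklore] -/
theorem sA_pos : 0 < sA := by
  unfold sA; exact div_pos (Real.arccos_pos.2 (by norm_num)) (by positivity)

/-- `sA < 1/4`. [folklore] -/
theorem sA_lt_quarter : sA < 1 / 4 := by
  have h : Real.arccos (5 / 16) < π / 2 := Real.arccos_lt_pi_div_two.2 (by norm_num)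
  have h2 : 2 * π * sA < 2 * π * (1 / 4) := by rw [two_pi_mul_sA]; linarith
  exact lt_of_mul_lt_mul_left h2 (by positivity)

/-- On `[0, sA]`, `cos 2πs ≥ 5/16` (cosine is decreasing on `[0, π]`). [folklore] -/
theorem cos_ge_of_le_sA {s : ℝ} (h0 : 0 ≤ s) (h1 : s ≤ sA) : 5 / 16 ≤ Real.cos (2 * π * s) := by
  rw [← cos_two_pi_sA]
  exact Real.cos_le_cos_of_nonneg_of_le_pi (by positivity)
    (by rw [two_pi_mul_sA]; exact Real.arccos_le_pi _) (by nlinarith [Real.pi_pos])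

/-- On `[sA, 1/2]`, `cos 2πs ≤ 5/16`. [folklore] -/
theorem cos_le_of_sA_le {s : ℝ} (h0 : sA ≤ s) (h1 : s ≤ 1 / 2) : Real.cos (2 * π * s) ≤ 5 / 16 := by
  rw [← cos_two_pi_sA]
  exact Real.cos_le_cos_of_nonneg_of_le_pi (by rw [two_pi_mul_sA]; exact Real.arccos_nonneg _)
    (by nlinarith [Real.pi_pos]) (by nlinarith [Real.pi_pos])

/-- `cos 2π(1 − s) = cos 2πs`. [folklore] -/
theorem cos_two_pi_one_sub (s : ℝ) : Real.cos (2 * π * (1 - s)) = Real.cos (2 * π * s) := by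
  rw [show 2 * π * (1 - s) = 2 * π - 2 * π * s by ring, Real.cos_two_pi_sub]

/-- On `[sA, 1 − sA]`, `cos 2πs ≤ 5/16`. [folklore] -/
theorem cos_le_of_mem_mid {s : ℝ} (h0 : sA ≤ s) (h1 : s ≤ 1 - sA) : Real.cos (2 * π * s) ≤ 5 / 16 := by
  rcases le_or_gt s (1 / 2) with h | h
  · exact cos_le_of_sA_le h0 h
  · rw [← cos_two_pi_one_sub]; exact cos_le_of_sA_le (by linarith) (by linarith)

/-- On `[1 − sA, 1]`, `cos 2πs ≥ 5/16`. [folklore] -/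
theorem cos_ge_of_ge {s : ℝ} (h0 : 1 - sA ≤ s) (h1 : s ≤ 1) : 5 / 16 ≤ Real.cos (2 * π * s) := by
  rw [← cos_two_pi_one_sub]; exact cos_ge_of_le_sA (by linarith) (by linarith)

/-! ### B. Where the arc lifts are -/

/-- A point of an arc lift with `cos 2πs > 1/4` lies in `V`. [folklore] -/
theorem arcPath_mem_coverV (i : ℕ) {ε : ℂ} (hε : ε ^ 2 = 1) {s : unitInterval} (hs : 1 / 4 < Real.cos (2 * π * s)) :
    arcPath g i ε hε s ∈ coverV g := by
  show (cx (arcPath g i ε hε s).1 ^ (2 * g + 1)).re < -(1 / 4 : ℝ)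
  rw [re_xpow_arcPath]; linarith

/-- A point of an arc lift with `cos 2πs < 3/8` lies in `U`. [folklore] -/
theorem arcPath_mem_coverU (i : ℕ) {ε : ℂ} (hε : ε ^ 2 = 1) {s : unitInterval} (hs : Real.cos (2 * π * s) < 3 / 8) :
    arcPath g i ε hε s ∈ coverU g := by
  show -(3 / 8 : ℝ) < (cx (arcPath g i ε hε s).1 ^ (2 * g + 1)).re
  rw [re_xpow_arcPath]; linarith

/-- Points of a segment `γ[a,b]`, `a ≤ b` in `[0,1]`, are values `γ r` with `r ∈ [a,b]`. [folklore] -/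
theorem segment_mem_of_forall {Y : Type*} [TopologicalSpace Y] {x y : Y} (γ : Path x y) {a b : ℝ}
    (ha : 0 ≤ a) (hab : a ≤ b) (hb : b ≤ 1) (P : Set Y)
    (hP : ∀ r : unitInterval, a ≤ r → (r : ℝ) ≤ b → γ r ∈ P) (t : unitInterval) : segment γ a b t ∈ P := by
  rw [segment_apply]
  have h1 : a ≤ a + (b - a) * t := by nlinarith [t.2.1]
  have h2 : a + (b - a) * t ≤ b := by nlinarith [t.2.2]
  have hmem : a + (b - a) * (t : ℝ) ∈ Set.Icc (0 : ℝ) 1 := ⟨by linarith, by linarith⟩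
  rw [show a + (b - a) * (t : ℝ) = ((⟨_, hmem⟩ : unitInterval) : ℝ) from rfl, Path.extend_extends']
  exact hP _ h1 h2

/-- The segment `[0, sA]` of an arc lift runs in `V`. [folklore] -/
theorem seg0_mem (i : ℕ) {ε : ℂ} (hε : ε ^ 2 = 1) (t : unitInterval) : segment (arcPath g i ε hε) 0 sA t ∈ coverV g :=
  segment_mem_of_forall _ le_rfl sA_pos.le (by linarith [sA_lt_quarter]) _
    (fun r h1 h2 => arcPath_mem_coverV i hε (by linarith [cos_ge_of_le_sA h1 h2])) t

/-- The segment `[sA, 1 − sA]` of an arc lift runs in `U`. [folklore] -/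
theorem seg1_mem (i : ℕ) {ε : ℂ} (hε : ε ^ 2 = 1) (t : unitInterval) : segment (arcPath g i ε hε) sA (1 - sA) t ∈ coverU g :=
  segment_mem_of_forall _ sA_pos.le (by linarith [sA_lt_quarter]) (by linarith [sA_pos]) _
    (fun r h1 h2 => arcPath_mem_coverU i hε (by linarith [cos_le_of_mem_mid h1 h2])) t

/-- The segment `[1 − sA, 1]` of an arc lift runs in `V`. [folklore] -/
theorem seg2_mem (i : ℕ) {ε : ℂ} (hε : ε ^ 2 = 1) (t : unitInterval) : segment (arcPath g i ε hε) (1 - sA) 1 t ∈ coverV g :=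
  segment_mem_of_forall _ (by linarith [sA_lt_quarter]) (by linarith [sA_pos]) le_rfl _
    (fun r h1 h2 => arcPath_mem_coverV i hε (by linarith [cos_ge_of_ge h1 h2])) t

/-! ### C. Homotopy bookkeeping -/

/-- Homotopies transport along casts of the end points. [folklore] -/
theorem homotopic_cast {Y : Type*} [TopologicalSpace Y] {x y x' y' : Y} {p q : Path x y} (h : p.Homotopic q)
    (hx : x' = x) (hy : y' = y) : (p.cast hx hy).Homotopic (q.cast hx hy) := by
  subst hx hy; exact h

/-- `γ ≃ (γ[0,a] · γ[a,b]) · γ[b,1]`. [folklore] -/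
theorem homotopic_triple_split {Y : Type*} [TopologicalSpace Y] {x y : Y} (γ : Path x y) (a b : ℝ) :
    γ.Homotopic ((((segment γ 0 a).trans (segment γ a b)).trans (segment γ b 1)).cast
      γ.extend_zero.symm γ.extend_one.symm) := by
  refine (homotopic_segment_zero_one γ).trans (homotopic_cast ?_ _ _)
  exact (((segment_trans_segment γ 0 a b).hcomp (Path.Homotopic.refl (segment γ b 1))).trans
    (segment_trans_segment γ 0 b 1)).symm

/-- Reversal commutes with casts. [folklore] -/
theorem symm_cast' {Y : Type*} [TopologicalSpace Y] {x y x' y' : Y} (p : Path x y) (hx : x' = x) (hy : y' = y) :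
    (p.cast hx hy).symm = p.symm.cast hy hx := rfl


/-! ### D. The alternating form of the arc loop -/

/-- `sA` as a point of `[0, 1]`. [folklore] -/
def sAI : unitInterval := ⟨sA, sA_pos.le, by linarith [sA_lt_quarter]⟩
/-- `1 − sA` as a point of `[0, 1]`. [folklore] -/
def sAI' : unitInterval := ⟨1 - sA, by linarith [sA_lt_quarter], by linarith [sA_pos]⟩

section Loop
variable (g) (i : ℕ)

/-- The upper arc lift `A⁺` of the `i`-th arc. [folklore] -/
abbrev Aup : Path (chordEnd g i) (chordEnd g (i + 1)) := arcPath g i 1 (one_pow 2)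
/-- The lower arc lift `A⁻` of the `i`-th arc. [folklore] -/
abbrev Adn : Path (chordEnd g i) (chordEnd g (i + 1)) := arcPath g i (-1) (by norm_num)

/-- `A⁺` and `A⁻` have the same end point. [folklore] -/
theorem ext_one_eq : (Aup g i).extend 1 = (Adn g i).extend 1 := by rw [Path.extend_one, Path.extend_one]
/-- `A⁺` and `A⁻` have the same starting point. [folklore] -/
theorem ext_zero_eq : (Aup g i).extend 0 = (Adn g i).extend 0 := by rw [Path.extend_zero, Path.extend_zero]

/-- **The alternating form of the `i`-th arc loop**: `((Q₀⁺·P₁⁺)·Q₁⁺)·(((Q₁⁻)⁻¹·(P₁⁻)⁻¹)·(Q₀⁻)⁻¹)` with `Q`'s in `V` and `P`'s in `U` (segments of `A^±` at `sA`, `1 − sA`). [folklore] -/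
def altLoop : Path ((Aup g i).extend 0) ((Aup g i).extend 0) :=
  (((segment (Aup g i) 0 sA).trans (segment (Aup g i) sA (1 - sA))).trans (segment (Aup g i) (1 - sA) 1)).trans
    (((((segment (Adn g i) (1 - sA) 1).symm).cast (ext_one_eq g i) rfl).trans (segment (Adn g i) sA (1 - sA)).symm).trans
      (((segment (Adn g i) 0 sA).symm).cast rfl (ext_zero_eq g i)))

/-- The intermediate form `A⁺[split].cast · (A⁻[split] reversed).cast` of the arc loop. [folklore] -/
def altLoop' : Path (chordEnd g i) (chordEnd g i) :=
  ((((segment (Aup g i) 0 sA).trans (segment (Aup g i) sA (1 - sA))).trans (segment (Aup g i) (1 - sA) 1)).cast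
      (Aup g i).extend_zero.symm (Aup g i).extend_one.symm).trans
    (((((segment (Adn g i) (1 - sA) 1).symm).trans (segment (Adn g i) sA (1 - sA)).symm).trans
      (segment (Adn g i) 0 sA).symm).cast (Adn g i).extend_one.symm (Adn g i).extend_zero.symm)

/-- The arc loop is homotopic to its split form. [folklore] -/
theorem arcLoop_homotopic_altLoop' : (arcLoop g i).Homotopic (altLoop' g i) := by
  have h1 := homotopic_triple_split (Aup g i) sA (1 - sA)
  have h2 := homotopic_triple_split (Adn g i) sA (1 - sA)
  refine (h1.hcomp h2.symm₂).trans ?_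
  unfold altLoop'
  refine (Path.Homotopic.refl _).hcomp ?_
  rw [symm_cast', Path.trans_symm, Path.trans_symm]
  exact homotopic_cast ⟨(Path.Homotopy.transAssoc _ _ _).symm⟩ _ _

/-- **`h(chainLoop g i) = h(altLoop g i)`** (chord ≃ arc ≃ split arc, and the Hurewicz class only sees the underlying map). [folklore] -/
theorem loopClass_chainLoop_eq_altLoop (R : Type) [CommRing R] :
    loopClass R R (1 : R) (chainLoop g i) = loopClass R R (1 : R) (altLoop g i) := by
  rw [loopClass_chainLoop_eq_arcLoop, loopClass_eq_of_homotopic R R (1 : R) (arcLoop_homotopic_altLoop' g i)]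
  exact loopClass_eq_of_ofPath_eq R R (1 : R) _ _ rfl

end Loop

/-! ### E. The clopen sets of the overlap and the indices of the switch points -/

/-- **The clopen set `C_j = {sheet 0, sector ≤ j}` of the overlap `U ∩ V`.** [folklore] -/
def Cset (g j : ℕ) : Set ↥(coverU g ∩ coverV g) := {p | (idxW p).1 = 0 ∧ ((idxW p).2 : ℕ) ≤ j}

/-- `C_j` is clopen (a preimage under the locally constant index map). [folklore] -/
theorem isClopen_Cset (j : ℕ) : IsClopen (Cset g j) :=
  (isClopen_discrete {q : Fin 2 × Fin (2 * g + 1) | q.1 = 0 ∧ (q.2 : ℕ) ≤ j}).preimage idxW.continuous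

/-- `μ₂⁰ = 1`. [folklore] -/
theorem rootU_two_pow_zero : rootU 2 ^ ((0 : Fin 2) : ℕ) = 1 := by rw [Fin.val_zero, pow_zero]

/-- `μ₂¹ = −1`. [folklore] -/
theorem rootU_two_pow_one : rootU 2 ^ ((1 : Fin 2) : ℕ) = -1 := by
  rw [Fin.val_one, pow_one, rootU, show (2 : ℂ) * Real.pi * Complex.I / (2 : ℕ) = Real.pi * Complex.I by push_cast; ring,
    Complex.exp_pi_mul_I]

/-- The sheet index of a point of `U ∩ V` on an arc lift is the exponent of its sheet sign `ε`. [folklore] -/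
theorem idxW_arc_fst (i : ℕ) {ε : ℂ} (hε : ε ^ 2 = 1) (k : Fin 2) (hk : ε = rootU 2 ^ (k : ℕ)) {s : unitInterval}
    (hs0 : 0 < (s : ℝ)) (hs1 : (s : ℝ) < 1) (p : ↥(coverU g ∩ coverV g)) (hp : p.1 = arcPath g i ε hε s) :
    (idxW p).1 = k := by
  rw [idxW_apply]
  show rootIdx two_ne_zero (cy p.1.1 / csqrt (cy p.1.1 ^ 2)) = k
  rw [hp, sheetSign_arcPath g i hε hs0 hs1, hk, rootIdx_rootU_pow]

/-- The sector index of a point of `U ∩ V` on the first half of an arc lift is `i`. [folklore] -/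
theorem idxW_arc_snd_lt (i : ℕ) (hi : i < 2 * g + 1) {ε : ℂ} (hε : ε ^ 2 = 1) {s : unitInterval}
    (hs : (s : ℝ) < 1 / 2) (p : ↥(coverU g ∩ coverV g)) (hp : p.1 = arcPath g i ε hε s) :
    (idxW p).2 = ⟨i, hi⟩ := by
  rw [idxW_apply]
  show rootIdx (odd_ne_zero g) (cx p.1.1 /
    (halfRoot (2 * g + 1) * prRoot (2 * g + 1) (-(cx p.1.1 ^ (2 * g + 1))))) = ⟨i, hi⟩
  rw [hp, sectorRoot_arcPath_of_lt_half g i ε hε hs]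
  exact rootIdx_rootU_pow (odd_ne_zero g) ⟨i, hi⟩

/-- The sector index of a point of `U ∩ V` on the second half of an arc lift is `i + 1`. [folklore] -/
theorem idxW_arc_snd_gt (i : ℕ) (hi : i + 1 < 2 * g + 1) {ε : ℂ} (hε : ε ^ 2 = 1) {s : unitInterval}
    (hs : 1 / 2 < (s : ℝ)) (p : ↥(coverU g ∩ coverV g)) (hp : p.1 = arcPath g i ε hε s) :
    (idxW p).2 = ⟨i + 1, hi⟩ := by
  rw [idxW_apply]
  show rootIdx (odd_ne_zero g) (cx p.1.1 /
    (halfRoot (2 * g + 1) * prRoot (2 * g + 1) (-(cx p.1.1 ^ (2 * g + 1))))) = ⟨i + 1, hi⟩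
  rw [hp, sectorRoot_arcPath_of_half_lt g i ε hε hs]
  exact rootIdx_rootU_pow (odd_ne_zero g) ⟨i + 1, hi⟩

/-- `0 < sA`. [folklore] -/
theorem sAI_pos : 0 < (sAI : ℝ) := sA_pos
/-- `sA < 1`. [folklore] -/
theorem sAI_lt_one : (sAI : ℝ) < 1 := by show sA < 1; linarith [sA_lt_quarter]
/-- `sA < 1/2`. [folklore] -/
theorem sAI_lt_half : (sAI : ℝ) < 1 / 2 := by show sA < 1 / 2; linarith [sA_lt_quarter]
/-- `0 < 1 − sA`. [folklore] -/
theorem sAI'_pos : 0 < (sAI' : ℝ) := by show 0 < 1 - sA; linarith [sA_lt_quarter]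
/-- `1 − sA < 1`. [folklore] -/
theorem sAI'_lt_one : (sAI' : ℝ) < 1 := by show 1 - sA < 1; linarith [sA_pos]
/-- `1/2 < 1 − sA`. [folklore] -/
theorem half_lt_sAI' : 1 / 2 < (sAI' : ℝ) := by show 1 / 2 < 1 - sA; linarith [sA_lt_quarter]

/-- The switch point `A⁺(sA)` lies in `U ∩ V`. [folklore] -/
theorem mem_up_sAI (i : ℕ) : arcPath g i 1 (one_pow 2) sAI ∈ coverU g ∩ coverV g :=
  ⟨arcPath_mem_coverU i _ (by show Real.cos (2 * Real.pi * sA) < 3 / 8; rw [cos_two_pi_sA]; norm_num),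
   arcPath_mem_coverV i _ (by show 1 / 4 < Real.cos (2 * Real.pi * sA); rw [cos_two_pi_sA]; norm_num)⟩
/-- The switch point `A⁺(1 − sA)` lies in `U ∩ V`. [folklore] -/
theorem mem_up_sAI' (i : ℕ) : arcPath g i 1 (one_pow 2) sAI' ∈ coverU g ∩ coverV g :=
  ⟨arcPath_mem_coverU i _ (by show Real.cos (2 * Real.pi * (1 - sA)) < 3 / 8; rw [cos_two_pi_one_sub, cos_two_pi_sA]; norm_num),
   arcPath_mem_coverV i _ (by show 1 / 4 < Real.cos (2 * Real.pi * (1 - sA)); rw [cos_two_pi_one_sub, cos_two_pi_sA]; norm_num)⟩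
/-- The switch point `A⁻(sA)` lies in `U ∩ V`. [folklore] -/
theorem mem_dn_sAI (i : ℕ) : arcPath g i (-1) (by norm_num) sAI ∈ coverU g ∩ coverV g :=
  ⟨arcPath_mem_coverU i _ (by show Real.cos (2 * Real.pi * sA) < 3 / 8; rw [cos_two_pi_sA]; norm_num),
   arcPath_mem_coverV i _ (by show 1 / 4 < Real.cos (2 * Real.pi * sA); rw [cos_two_pi_sA]; norm_num)⟩
/-- The switch point `A⁻(1 − sA)` lies in `U ∩ V`. [folklore] -/
theorem mem_dn_sAI' (i : ℕ) : arcPath g i (-1) (by norm_num) sAI' ∈ coverU g ∩ coverV g :=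
  ⟨arcPath_mem_coverU i _ (by show Real.cos (2 * Real.pi * (1 - sA)) < 3 / 8; rw [cos_two_pi_one_sub, cos_two_pi_sA]; norm_num),
   arcPath_mem_coverV i _ (by show 1 / 4 < Real.cos (2 * Real.pi * (1 - sA)); rw [cos_two_pi_one_sub, cos_two_pi_sA]; norm_num)⟩

/-- `A⁺(sA) ∈ C_j ↔ i ≤ j`. [folklore] -/
theorem mem_Cset_up_sAI (i : ℕ) (hi : i + 1 < 2 * g + 1) (j : ℕ) :
    (⟨_, mem_up_sAI (g := g) i⟩ : ↥(coverU g ∩ coverV g)) ∈ Cset g j ↔ i ≤ j := by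
  have h1 := idxW_arc_fst i (one_pow 2) 0 (by rw [rootU_two_pow_zero]) sAI_pos sAI_lt_one
    (⟨_, mem_up_sAI (g := g) i⟩ : ↥(coverU g ∩ coverV g)) rfl
  have h2 := idxW_arc_snd_lt i (by omega) (one_pow 2) sAI_lt_half
    (⟨_, mem_up_sAI (g := g) i⟩ : ↥(coverU g ∩ coverV g)) rfl
  show (idxW _).1 = 0 ∧ ((idxW _).2 : ℕ) ≤ j ↔ i ≤ j
  rw [h1, h2]
  simp
/-- `A⁺(1 − sA) ∈ C_j ↔ i + 1 ≤ j`. [folklore] -/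
theorem mem_Cset_up_sAI' (i : ℕ) (hi : i + 1 < 2 * g + 1) (j : ℕ) :
    (⟨_, mem_up_sAI' (g := g) i⟩ : ↥(coverU g ∩ coverV g)) ∈ Cset g j ↔ i + 1 ≤ j := by
  have h1 := idxW_arc_fst i (one_pow 2) 0 (by rw [rootU_two_pow_zero]) sAI'_pos sAI'_lt_one
    (⟨_, mem_up_sAI' (g := g) i⟩ : ↥(coverU g ∩ coverV g)) rfl
  have h2 := idxW_arc_snd_gt i hi (one_pow 2) half_lt_sAI'
    (⟨_, mem_up_sAI' (g := g) i⟩ : ↥(coverU g ∩ coverV g)) rfl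
  show (idxW _).1 = 0 ∧ ((idxW _).2 : ℕ) ≤ j ↔ i + 1 ≤ j
  rw [h1, h2]
  simp
/-- `A⁻(sA) ∉ C_j` (lower sheet). [folklore] -/
theorem not_mem_Cset_dn_sAI (i : ℕ) (j : ℕ) :
    (⟨_, mem_dn_sAI (g := g) i⟩ : ↥(coverU g ∩ coverV g)) ∉ Cset g j := by
  intro hmem
  have h1 : (idxW (⟨_, mem_dn_sAI (g := g) i⟩ : ↥(coverU g ∩ coverV g))).1 = 0 := hmem.1
  rw [idxW_arc_fst i (by norm_num) 1 (by rw [rootU_two_pow_one]) sAI_pos sAI_lt_one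
    (⟨_, mem_dn_sAI (g := g) i⟩ : ↥(coverU g ∩ coverV g)) rfl] at h1
  exact absurd h1 (by decide)
/-- `A⁻(1 − sA) ∉ C_j` (lower sheet). [folklore] -/
theorem not_mem_Cset_dn_sAI' (i : ℕ) (j : ℕ) :
    (⟨_, mem_dn_sAI' (g := g) i⟩ : ↥(coverU g ∩ coverV g)) ∉ Cset g j := by
  intro hmem
  have h1 : (idxW (⟨_, mem_dn_sAI' (g := g) i⟩ : ↥(coverU g ∩ coverV g))).1 = 0 := hmem.1
  rw [idxW_arc_fst i (by norm_num) 1 (by rw [rootU_two_pow_one]) sAI'_pos sAI'_lt_one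
    (⟨_, mem_dn_sAI' (g := g) i⟩ : ↥(coverU g ∩ coverV g)) rfl] at h1
  exact absurd h1 (by decide)

/-! ### F. The main computation -/

/-- The interiors of `U`, `V` cover the base. [folklore] -/
theorem interior_cover_eq (g : ℕ) : interior (coverU g) ∪ interior (coverV g) = Set.univ := by
  rw [(isOpen_coverU g).interior_eq, (isOpen_coverV g).interior_eq, coverU_union_coverV]

/-- **`θ_j (∂_MV h(altLoop i)) = [i+1 ≤ j] − [i ≤ j]`** — Hatcher's `∂[z] = [∂ z_U]` read through the counting functional of `C_j`. [folklore] -/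
theorem theta_delta_altLoop (i : ℕ) (hi : i + 1 < 2 * g + 1) (j : ℕ) :
    clopenCountH ℤ (isClopen_Cset (g := g) j)
      (mayerVietoris.δ ℤ ℤ (coverU g) (coverV g)
        (relativeSingularHomology.isIso_map_of_interior_union_interior_holds ℤ ℤ (Base g)) (interior_cover_eq g) 0
        (loopClass ℤ ℤ (1 : ℤ) (altLoop g i))) =
      (if i + 1 ≤ j then 1 else 0) - (if i ≤ j then 1 else 0) := by
  have hp1 : (1 : ℂ) ^ 2 = 1 := one_pow 2
  have hm1 : (-1 : ℂ) ^ 2 = 1 := by norm_num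
  have H2 := mayerVietoris.δ_loopClass_alternating (R := ℤ) (U := coverU g) (V := coverV g)
    (relativeSingularHomology.isIso_map_of_interior_union_interior_holds ℤ ℤ (Base g)) (interior_cover_eq g)
    (segment (Aup g i) 0 sA) (segment (Aup g i) sA (1 - sA)) (segment (Aup g i) (1 - sA) 1)
    (((segment (Adn g i) (1 - sA) 1).symm).cast (ext_one_eq g i) rfl) (segment (Adn g i) sA (1 - sA)).symm
    (((segment (Adn g i) 0 sA).symm).cast rfl (ext_zero_eq g i))
    (fun t => seg0_mem i hp1 t) (fun t => seg1_mem i hp1 t) (fun t => seg2_mem i hp1 t)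
    (fun t => seg2_mem i hm1 (unitInterval.symm t)) (fun t => seg1_mem i hm1 (unitInterval.symm t))
    (fun t => seg0_mem i hm1 (unitInterval.symm t))
  have H2' : mayerVietoris.δ ℤ ℤ (coverU g) (coverV g)
      (relativeSingularHomology.isIso_map_of_interior_union_interior_holds ℤ ℤ (Base g)) (interior_cover_eq g) 0
      (loopClass ℤ ℤ (1 : ℤ) (altLoop g i)) = _ := H2
  rw [H2', zeroChainCls, clopenCountH_homologyCls, map_sub, map_add, map_sub, clopenCount_single, clopenCount_single,
    clopenCount_single, clopenCount_single, SingularSimplex.pt_ofPoint, SingularSimplex.pt_ofPoint,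
    SingularSimplex.pt_ofPoint, SingularSimplex.pt_ofPoint, one_mul, one_mul, one_mul, one_mul]
  -- identify the four points
  have e0 : (⟨(Aup g i).extend sA, (segment (Aup g i) sA (1 - sA)).source ▸ seg1_mem i hp1 0,
      (segment (Aup g i) 0 sA).target ▸ seg0_mem i hp1 1⟩ : ↥(coverU g ∩ coverV g)) = ⟨_, mem_up_sAI (g := g) i⟩ :=
    Subtype.ext (Path.extend_extends' _ sAI)
  have e1 : (⟨(Aup g i).extend (1 - sA), (segment (Aup g i) sA (1 - sA)).target ▸ seg1_mem i hp1 1,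
      (segment (Aup g i) (1 - sA) 1).source ▸ seg2_mem i hp1 0⟩ : ↥(coverU g ∩ coverV g)) = ⟨_, mem_up_sAI' (g := g) i⟩ :=
    Subtype.ext (Path.extend_extends' _ sAI')
  have e2 : (⟨(Adn g i).extend (1 - sA), (segment (Adn g i) sA (1 - sA)).symm.source ▸ seg1_mem i hm1 (unitInterval.symm 0),
      (((segment (Adn g i) (1 - sA) 1).symm).cast (ext_one_eq g i) rfl).target ▸ seg2_mem i hm1 (unitInterval.symm 1)⟩ :
        ↥(coverU g ∩ coverV g)) = ⟨_, mem_dn_sAI' (g := g) i⟩ :=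
    Subtype.ext (Path.extend_extends' _ sAI')
  have e3 : (⟨(Adn g i).extend sA, (segment (Adn g i) sA (1 - sA)).symm.target ▸ seg1_mem i hm1 (unitInterval.symm 1),
      (((segment (Adn g i) 0 sA).symm).cast rfl (ext_zero_eq g i)).source ▸ seg0_mem i hm1 (unitInterval.symm 0)⟩ :
        ↥(coverU g ∩ coverV g)) = ⟨_, mem_dn_sAI (g := g) i⟩ :=
    Subtype.ext (Path.extend_extends' _ sAI)
  rw [e0, e1, e2, e3, Set.indicator_of_notMem (not_mem_Cset_dn_sAI i j), Set.indicator_of_notMem (not_mem_Cset_dn_sAI' i j)]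
  by_cases h1 : i + 1 ≤ j
  · rw [Set.indicator_of_mem ((mem_Cset_up_sAI' i hi j).2 h1), Set.indicator_of_mem ((mem_Cset_up_sAI i hi j).2 (by omega)),
      if_pos h1, if_pos (by omega)]
    simp
  · rw [Set.indicator_of_notMem (fun h' => h1 ((mem_Cset_up_sAI' i hi j).1 h')), if_neg h1]
    by_cases h0 : i ≤ j
    · rw [Set.indicator_of_mem ((mem_Cset_up_sAI i hi j).2 h0), if_pos h0]; simp
    · rw [Set.indicator_of_notMem (fun h' => h0 ((mem_Cset_up_sAI i hi j).1 h')), if_neg h0]; simp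

/-- **The functionals dual to the chain loops** (`Ψ_j = −θ_j ∘ ∂_MV`): `Ψ (h(chainLoop g i)) = e_i`, `i < 2g`. [cite: Milnor1968, Thm. 9.1 and Lemma 9.4] -/
theorem exists_dualFunctionals (g : ℕ) :
    ∃ Ψ : singularHomology ℤ ℤ (Base g) 1 →ₗ[ℤ] (Fin (2 * g) → ℤ),
      ∀ i : Fin (2 * g), Ψ (loopClass ℤ ℤ (1 : ℤ) (chainLoop g i)) = Pi.single i 1 := by
  let δMV := mayerVietoris.δ ℤ ℤ (coverU g) (coverV g)
    (relativeSingularHomology.isIso_map_of_interior_union_interior_holds ℤ ℤ (Base g)) (interior_cover_eq g) 0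
  let θ : ℕ → (singularHomology ℤ ℤ ↥(coverU g ∩ coverV g) 0 →ₗ[ℤ] ℤ) := fun j => clopenCountH ℤ (isClopen_Cset (g := g) j)
  refine ⟨LinearMap.pi fun j : Fin (2 * g) => -((θ j).comp δMV.hom), fun i => ?_⟩
  funext j
  rw [LinearMap.pi_apply, LinearMap.neg_apply, LinearMap.comp_apply, loopClass_chainLoop_eq_altLoop]
  have key := theta_delta_altLoop (g := g) (i : ℕ) (by omega) (j : ℕ)
  change (θ j) (δMV (loopClass ℤ ℤ 1 (altLoop g i))) = _ at key
  change -((θ j) (δMV (loopClass ℤ ℤ 1 (altLoop g i)))) = _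
  rw [key, Pi.single_apply]
  by_cases hij : j = i
  · subst hij; simp
  · rw [if_neg hij]
    have : (i : ℕ) ≠ j := fun h => hij (Fin.ext h.symm)
    by_cases h1 : (i : ℕ) + 1 ≤ j
    · rw [if_pos h1, if_pos (by omega)]; simp
    · rw [if_neg h1, if_neg (by omega)]; simp

end LefschetzBase

end Literature.Topology.FourManifolds
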